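import Mathlib
import Summits.Ventures.PercRepro2.HCov
import Summits.Ventures.PercRepro2.RootLeafUHalf
import Summits.Ventures.PercRepro2.RootLeafUKMaster
import Summits.Ventures.PercRepro2.RootLeafUKSide
import Summits.Ventures.PercRepro2.RootLeafUKSideSup

/-!
# The `o ∈ K` half of the second root-leaf coefficient: the SLACK CLASS `(2β·M − A)·δK ≤ 2β·(c) + ℰ·q6`
(blind cell PercRepro2, p4 g27; S3 (G4-u) item (ap))

`KSide.W_mul_T2oK_eq` writes `W′·T2oK = A·δK + 2β·(b) + 2β·(c) + ℰ·q6` with `(c) ≥ 0` (`c_nonneg`), `q6 ≥ 0`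
(`q6_nonneg`), `ℰ ≥ 0` (`Ee_nonneg`), and `KSup.F1M_nonneg` gives `(b) ≥ −M·δK` for every constant `M ≥ 0` dominating
`g(L) = P_{G∖L}(a₂ ↔ b)` on the clusters `L = C(u) ∋ c`.  Hence

  `W′·T2oK ≥ (A − 2β·M)·δK + 2β·(c) + ℰ·q6`,

and **`T2oK_nonneg_of_slack_class_M`**: `0 ≤ T2oK` whenever `(2β·M − A)·δK ≤ 2β·(c) + ℰ·q6` — the class
`A ≥ 2β·M` of `KSup.T2oK_nonneg_of_A_ge_M` enlarged by the two nonnegative slack terms of the `W′`-identity that the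
reduction to `K3` drops; **`T2oK_nonneg_of_slack_class_guc`** is the instance `M = g({u, c}) = P_{G − {u, c}}(a₂ ↔ b)`
(`delClusterProb` at `{u, c}`).  On the census of this seat (random instances n = 5–7, uniform and extreme weights,
900 + 900 instances) the class with `M = g({u, c})` contains EVERY instance, including all of the residual regime
`A < 2β·M*` of RootLeafUKSideSup; its complement — `(2β·M − A)·δK > 2β·(c) + ℰ·q6` — is the only place where
`0 ≤ T2oK` is still open.  No definitions; standard axioms.
-/

namespace Summit.Ventures.PercRepro2

open UnionCluster CovForm

namespace RootLeafU

namespace KSup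

variable {V : Type*} {E : Type*} [Fintype E] [DecidableEq E] [Fintype V] [DecidableEq V]
  {R : Type*} [Field R] [LinearOrder R] [IsStrictOrderedRing R]

section Slack

variable (p : E → R) (ends : E → Sym2 V) (o a₂ c b u : V) (M : R)

/-- **`W′·T2oK ≥ (A − 2β·M)·δK + 2β·(c) + ℰ·q6`** for every constant `M ≥ 0` dominating `g` on the clusters
`C(u) ∋ c` (the `W′`-identity with `(b) ≥ −M·δK` from `F1M_nonneg`). -/
theorem W_mul_T2oK_ge (hp : IsProbVec p) (hM0 : 0 ≤ M)
    (hM : ∀ ω : Config E, c ∈ cluster ends ω u →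
      delClusterProb p ends a₂ {W : Set V | b ∈ W} (cluster ends ω u) ≤ M) :
    (((prob p (PDEvent ends u a₂ c) * prob p (connEvent ends a₂ b) + prob p (avoidAll ends a₂ {c}) * gap p ends u a₂ b) + (prob p Set.univ * EQb3 p ends u a₂ c b + prob p Set.univ * PDb p ends u a₂ c b + prob p (connEvent ends a₂ b) * EQ3 p ends u a₂ c + prob p (connEvent ends a₂ b) * prob p (avoidAll ends a₂ {u}) - (prob p Set.univ - prob p (avoidAll ends a₂ {c})) * gap p ends u a₂ b)) - 2 * (prob p Set.univ * prob p (PDEvent ends u a₂ c) + prob p (avoidAll ends a₂ {c}) * prob p (avoidAll ends a₂ {u})) * M) * (prob p (TEvent ends a₂ u c) * prob p (PDEvent ends u a₂ c ∩ connEvent ends a₂ o) - prob p (PDEvent ends u a₂ c) * prob p (TEvent ends a₂ u c ∩ connEvent ends a₂ o)) + 2 * (prob p Set.univ * prob p (PDEvent ends u a₂ c) + prob p (avoidAll ends a₂ {c}) * prob p (avoidAll ends a₂ {u})) * ((prob p (PDEvent ends u a₂ c ∩ connEvent ends a₂ o) + prob p (TEvent ends a₂ u c ∩ connEvent ends a₂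 o)) * (prob p (PDEvent ends u a₂ c ∩ connEvent ends u b) + prob p (TEvent ends a₂ u c ∩ connEvent ends u b)) - (prob p (PDEvent ends u a₂ c) + prob p (TEvent ends a₂ u c)) * (prob p (PDEvent ends u a₂ c ∩ (connEvent ends a₂ o ∩ connEvent ends u b)) + prob p (TEvent ends a₂ u c ∩ (connEvent ends a₂ o ∩ connEvent ends u b)))) + Ee p ends a₂ c b u * (prob p (avoidAll ends a₂ {c} ∩ connEvent ends a₂ o) * (prob p (PDEvent ends u a₂ c) + prob p (TEvent ends a₂ u c)) - prob p (avoidAll ends a₂ {c}) * (prob p (PDEvent ends u a₂ c ∩ connEvent ends a₂ o) + prob p (TEvent ends a₂ u c ∩ connEvent ends a₂ o)))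
      ≤ (prob p (PDEvent ends u a₂ c) + prob p (TEvent ends a₂ u c)) * T2oK p ends o a₂ c b u := by
  classical
  have key := KSide.W_mul_T2oK_eq p ends o a₂ c b u
  have hF := F1M_nonneg p ends o a₂ c b u M hp hM0 hM
  have n_d0 := prob_nonneg hp (avoidAll ends a₂ {c})
  have n_Z := prob_nonneg hp (avoidAll ends a₂ {u})
  have n_D := prob_nonneg hp (PDEvent ends u a₂ c)
  have n_β : 0 ≤ (prob p Set.univ * prob p (PDEvent ends u a₂ c) + prob p (avoidAll ends a₂ {c}) * prob p (avoidAll ends a₂ {u})) := by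
    rw [prob_univ]
    nlinarith [mul_nonneg n_d0 n_Z]
  rw [key]
  nlinarith [mul_nonneg n_β hF]

/-- **THE SLACK CLASS**: `0 ≤ T2oK` whenever `(2β·M − A)·δK ≤ 2β·(c) + ℰ·q6`, for a constant `M ≥ 0` dominating
`g(L) = P_{G∖L}(a₂ ↔ b)` on the clusters `L = C(u) ∋ c` (contains the class `2β·M ≤ A` of `T2oK_nonneg_of_A_ge_M`,
since `(c), q6, ℰ, δK ≥ 0`). -/
theorem T2oK_nonneg_of_slack_class_M (hp : IsProbVec p) (hM0 : 0 ≤ M)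
    (hM : ∀ ω : Config E, c ∈ cluster ends ω u →
      delClusterProb p ends a₂ {W : Set V | b ∈ W} (cluster ends ω u) ≤ M)
    (hcls : (2 * (prob p Set.univ * prob p (PDEvent ends u a₂ c) + prob p (avoidAll ends a₂ {c}) * prob p (avoidAll ends a₂ {u})) * M - ((prob p (PDEvent ends u a₂ c) * prob p (connEvent ends a₂ b) + prob p (avoidAll ends a₂ {c}) * gap p ends u a₂ b) + (prob p Set.univ * EQb3 p ends u a₂ c b + prob p Set.univ * PDb p ends u a₂ c b + prob p (connEvent ends a₂ b) * EQ3 p ends u a₂ c + prob p (connEvent ends a₂ b) * prob p (avoidAll ends a₂ {u}) - (prob p Set.univ - prob p (avoidAll ends a₂ {c})) * gap p ends u a₂ b))) * (prob p (TEvent ends a₂ u c) * prob p (PDEvent ends u a₂ c ∩ connEvent ends a₂ o) - prob p (PDEvent ends u a₂ c) * prob p (TEvent ends a₂ u c ∩ connEvent ends a₂ o)) ≤ 2 * (prob p Set.univ * prob p (PDEvent ends u a₂ c) + prob p (avoidAll ends a₂ {c}) * prob p (avoidAll ends a₂ {u})) * ((prob p (PDEvent ends u a₂ c ∩ connEvent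 ends a₂ o) + prob p (TEvent ends a₂ u c ∩ connEvent ends a₂ o)) * (prob p (PDEvent ends u a₂ c ∩ connEvent ends u b) + prob p (TEvent ends a₂ u c ∩ connEvent ends u b)) - (prob p (PDEvent ends u a₂ c) + prob p (TEvent ends a₂ u c)) * (prob p (PDEvent ends u a₂ c ∩ (connEvent ends a₂ o ∩ connEvent ends u b)) + prob p (TEvent ends a₂ u c ∩ (connEvent ends a₂ o ∩ connEvent ends u b)))) + Ee p ends a₂ c b u * (prob p (avoidAll ends a₂ {c} ∩ connEvent ends a₂ o) * (prob p (PDEvent ends u a₂ c) + prob p (TEvent ends a₂ u c)) - prob p (avoidAll ends a₂ {c}) * (prob p (PDEvent ends u a₂ c ∩ connEvent ends a₂ o) + prob p (TEvent ends a₂ u c ∩ connEvent ends a₂ o)))) :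
    0 ≤ T2oK p ends o a₂ c b u := by
  classical
  have hge := W_mul_T2oK_ge p ends o a₂ c b u M hp hM0 hM
  have hE := Ee_nonneg p ends a₂ c b u hp
  have n_D := prob_nonneg hp (PDEvent ends u a₂ c)
  have n_tp := prob_nonneg hp (TEvent ends a₂ u c)
  have n_e0 := prob_nonneg hp (avoidAll ends a₂ {c} ∩ connEvent ends a₂ o)
  rcases eq_or_lt_of_le (add_nonneg n_D n_tp) with hW0 | hWpos
  · -- `W′ = 0`: `D = t′ = 0`, every `PD`- and `T′`-mass vanishes, `T2oK = ℰ·e0`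
    have hD : prob p (PDEvent ends u a₂ c) = 0 := by linarith
    have ht : prob p (TEvent ends a₂ u c) = 0 := by linarith
    have z : ∀ X : Set (Config E), prob p (PDEvent ends u a₂ c ∩ X) = 0 :=
      fun X => le_antisymm (hD ▸ prob_mono hp Set.inter_subset_left) (prob_nonneg hp _)
    have z' : ∀ X : Set (Config E), prob p (TEvent ends a₂ u c ∩ X) = 0 :=
      fun X => le_antisymm (ht ▸ prob_mono hp Set.inter_subset_left) (prob_nonneg hp _)
    unfold T2oK
    rw [z, z, z', z', z', hD]
    simp only [mul_zero, zero_mul, sub_zero, add_zero, zero_add]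
    exact mul_nonneg hE n_e0
  · have hpos : 0 ≤ (prob p (PDEvent ends u a₂ c) + prob p (TEvent ends a₂ u c)) * T2oK p ends o a₂ c b u := by
      linarith [hge, hcls]
    by_contra hneg
    have := mul_neg_of_pos_of_neg hWpos (not_le.mp hneg)
    linarith

/-- **The slack class with `M = g({u, c}) = P_{G − {u, c}}(a₂ ↔ b)`**: `0 ≤ T2oK` whenever
`(2β·g({u,c}) − A)·δK ≤ 2β·(c) + ℰ·q6`. -/
theorem T2oK_nonneg_of_slack_class_guc (hp : IsProbVec p)
    (hcls : (2 * (prob p Set.univ * prob p (PDEvent ends u a₂ c) + prob p (avoidAll ends a₂ {c}) * prob p (avoidAll ends a₂ {u})) * delClusterProb p ends a₂ {W : Set V | b ∈ W} ({u, c} : Set V) - ((prob p (PDEvent ends u a₂ c) * prob p (connEvent ends a₂ b) + prob p (avoidAll ends a₂ {c}) * gap p ends u a₂ b) + (prob p Set.univ * EQb3 p ends u a₂ c b + prob p Set.univ * PDb p ends u a₂ c b + prob p (connEvent ends a₂ b) * EQ3 p ends u a₂ c + prob p (connEvent ends a₂ b) * prob p (avoidAll ends a₂ {u}) - (prob p Set.univ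 - prob p (avoidAll ends a₂ {c})) * gap p ends u a₂ b))) * (prob p (TEvent ends a₂ u c) * prob p (PDEvent ends u a₂ c ∩ connEvent ends a₂ o) - prob p (PDEvent ends u a₂ c) * prob p (TEvent ends a₂ u c ∩ connEvent ends a₂ o)) ≤ 2 * (prob p Set.univ * prob p (PDEvent ends u a₂ c) + prob p (avoidAll ends a₂ {c}) * prob p (avoidAll ends a₂ {u})) * ((prob p (PDEvent ends u a₂ c ∩ connEvent ends a₂ o) + prob p (TEvent ends a₂ u c ∩ connEvent ends a₂ o)) * (prob p (PDEvent ends u a₂ c ∩ connEvent ends u b) + prob p (TEvent ends a₂ u c ∩ connEvent ends u b)) - (prob p (PDEvent ends u a₂ c) + prob p (TEvent ends a₂ u c)) * (prob p (PDEvent ends u a₂ c ∩ (connEvent ends a₂ o ∩ connEvent ends u b)) + prob p (TEvent ends a₂ u c ∩ (connEvent ends a₂ o ∩ connEvent ends u b)))) + Ee p ends a₂ c b u * (prob p (avoidAll ends a₂ {c} ∩ connEvent ends a₂ o) * (prob p (PDEvent ends u a₂ c) + prob p (TEvent ends a₂ u c)) - prob p (avoidAll ends a₂ {c}) * (prob p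 (PDEvent ends u a₂ c ∩ connEvent ends a₂ o) + prob p (TEvent ends a₂ u c ∩ connEvent ends a₂ o)))) :
    0 ≤ T2oK p ends o a₂ c b u :=
  T2oK_nonneg_of_slack_class_M p ends o a₂ c b u _ hp (delClusterProb_nonneg p hp ends a₂ _ _)
    (fun ω hc => delClusterProb_cluster_le_guc p ends a₂ c b u hp ω hc) hcls

end Slack

end KSup

end RootLeafU

end Summit.Ventures.PercRepro2
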